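import Literature.AlgebraicGeometry.Frobenioids.ArchimedeanFSMIProjectionR
import Literature.AlgebraicGeometry.Frobenioids.ArchimedeanFSMCounterexample
import HarnessLib

/-!
# Frobenioids II, Proposition 3.4 (vi): the bundled item PROVED over every base
# (abc-iut cell, layer L1, node `FrdII:Prop3.4(vi)`; FACT-LIST row F-0812 `ArchFrd.Prop34_vi`)

Mochizuki, *The geometry of Frobenioids II: poly-Frobenioids*, Kyushu J. Math. **62** (2008)
401–460, §3, Proposition 3.4 (vi) p. 30 [cite: MochizukiFrdII2008, Prop 3.4 (vi) p.30]:

> "(vi) If `φ` is a morphism of `F` such that `φ_D := Base(φ)` admits a factorization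
> `φ_D = α_D ∘ β_D` in `D`, then there exist morphisms `α`, `β` of `F` lifting `α_D`, `β_D`,
> respectively, such that `φ = α ∘ β` in `F`. In particular, irreducible morphisms of `F` project to
> either isomorphisms or irreducible morphisms of `D`; FSMI-morphisms [cf. (iii)] of `F` project to
> either isomorphisms or FSMI-morphisms of `D`."

PROOF-ONLY assembly file (nothing is defined). The cell's bundled statement of item (vi) for
`F ∈ {A, N, R}` — `ArchFrd.Prop34_vi π`: main clause + both "in particular" clauses at the three named
towers `towerA π`, `towerN π`, `towerR π` (`ArchimedeanFSM.lean`) — is PROVED here for EVERY base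
`π : D ⥤ D₀`, with no hypothesis (`prop34_vi_holds`), by re-bracketing three landed conjunctions:
* the main clause `prop34_vi_main` and the irreducibility clause `prop34_vi_irreducible`
  (`ArchimedeanFSMLifting.lean`: explicit lifts of factorizations along base change, Def. 3.1 (iv));
* the FSMI clause `prop34_vi_fsmi` (`ArchimedeanFSMIProjection{,A,R}.lean`, abc-iut-f-011): an
  FSMI-morphism of `F` projects to a monomorphism of `D` — over an isomorphism of `D₀` by condition (a)
  of item (ii); over `Spec ℂ → Spec ℝ` because irreducibility forces the domain's angular region to be
  isotropic (naive isotropic hull factorization) and then two arrows of `D` equalized by `φ_D` lift,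
  along Galois-twisted endomorphisms of the domain, to arrows of `F` equalized by `φ`.
So the earlier conditional routes to this row are superseded: `prop34_vi_of_prop34_iii` (item (iii) is
FALSE as typed, `not_prop34_iii_id`) and `prop34_vi_of_isComplex` / `Prop34_viR` (complex regime) are no
longer needed — item (vi) as typed does not depend on item (iii), although print cites "[cf. (iii)]".
No statement of the paper is strengthened (the typed item is proved as typed); typed ≠ endorsed; no
side is taken on [IUTchIII] Cor. 3.12.
-/

namespace Literature.AlgebraicGeometry.Frobenioids

open CategoryTheory

namespace ArchFrd

universe v u

variable {D : Type u} [Category.{v} D] (π : D ⥤ D0)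

/-- **Proposition 3.4 (vi)** (for `F = A, N, R`), with both "in particular" clauses — PROVED over every
base `π : D ⥤ D₀` (FACT-LIST row F-0812 `ArchFrd.Prop34_vi`; kernel witness, no hypothesis): main
clause `prop34_vi_main`, irreducibility clause `prop34_vi_irreducible`, FSMI clause `prop34_vi_fsmi`.
[cite: MochizukiFrdII2008, Prop 3.4 (vi) p.30] -/
theorem prop34_vi_holds : Literature.AlgebraicGeometry.Frobenioids.ArchFrd.Prop34_vi π :=
  ⟨⟨A.propVI π, (prop34_vi_irreducible π).1, A.propVI_FSMI π⟩,
    ⟨N.propVI π, (prop34_vi_irreducible π).2.1, N.propVI_FSMI π⟩,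
    ⟨R.propVI π, (prop34_vi_irreducible π).2.2, R.propVI_FSMI π⟩⟩

/-- `Prop34_vi` — `_holds` alias of `prop34_vi_holds` above under the fact's exact name (appended
2026-08-28, D-0026 bookkeeping: the proof term is the existing theorem of this file; no statement,
definition or attribute is edited; no new named fact; the ledger's debt table listed the fact
unproved). [cite: MochizukiFrdII2008, Prop 3.4 (vi) p.30] -/
theorem _root_.Literature.AlgebraicGeometry.Frobenioids.ArchFrd.Prop34_vi_holds :
    Literature.AlgebraicGeometry.Frobenioids.ArchFrd.Prop34_vi π :=
  _root_.Literature.AlgebraicGeometry.Frobenioids.ArchFrd.prop34_vi_holds (π := π)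

/-- **Proposition 3.4 (vi), per named tower**: the three clauses of item (vi) for the angular Frobenioid
`F = A`, every base. [cite: MochizukiFrdII2008, Prop 3.4 (vi) p.30] -/
theorem A.propVI_all : (towerA π).PropVI ∧ (towerA π).PropVI_irreducible ∧ (towerA π).PropVI_FSMI :=
  (prop34_vi_holds π).1

/-- **Proposition 3.4 (vi), per named tower**: the three clauses of item (vi) for the non-rigidified
angloid `F = N`, every base. [cite: MochizukiFrdII2008, Prop 3.4 (vi) p.30] -/
theorem N.propVI_all : (towerN π).PropVI ∧ (towerN π).PropVI_irreducible ∧ (towerN π).PropVI_FSMI :=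
  (prop34_vi_holds π).2.1

/-- **Proposition 3.4 (vi), per named tower**: the three clauses of item (vi) for the rigidified angloid
`F = R`, every base. [cite: MochizukiFrdII2008, Prop 3.4 (vi) p.30] -/
theorem R.propVI_all : (towerR π).PropVI ∧ (towerR π).PropVI_irreducible ∧ (towerR π).PropVI_FSMI :=
  (prop34_vi_holds π).2.2

/-- The hypothesis of the earlier conditional route `prop34_vi_of_prop34_iii` is superfluous: item (vi)
as typed holds at the base `π = 𝟭 D₀`, where item (iii) as typed FAILS (`not_prop34_iii_id`).
[cite: MochizukiFrdII2008, Prop 3.4 (vi) p.30] -/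
theorem prop34_vi_id_and_not_prop34_iii_id : Prop34_vi (𝟭 D0) ∧ ¬ Prop34_iii (𝟭 D0) :=
  ⟨prop34_vi_holds (𝟭 D0), not_prop34_iii_id⟩

end ArchFrd

end Literature.AlgebraicGeometry.Frobenioids
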